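/-
Copyright (c) 2026. All rights reserved.
Released under Apache 2.0 license as described in the file LICENSE.
-/
import Literature.NumberTheory.Automorphic.QuaternionicSIdealClassesAdmissible
import HarnessLib

/-!
# The nontrivial sign patterns are cuspidal: `M^χ(O)` has degree zero and is orthogonal to the Eisenstein vector for
# `χ ≠ +_T`, and `dim (M^{+_T}(O) ∩ M(O)⁰) = h_T − 1` (Martin 2018, §3.3: `M^χ = S^χ` unless `χ = +`; (3.9))

[tag: quaternion_algebra] [tag: eichler_order] [tag: hecke_operator]

Topic `NumberTheory/Automorphic`. Lane `lit-hodgefound`, seat p12, gen 52 — sequel of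
`BrandtModuleSignPatternDecomposition.lean` (`M(O) = ⊕_χ M^χ(O)`), `QuaternionicSIdealClasses.lean`
(`dim M^{+_T}(O) = h_T = #Cl_T(O)`) and `DefiniteMaximalOrdersHeckeAtkinLehner.lean` §4 (one ramified involution:
`E₋` has degree zero and is orthogonal to Gross's Eisenstein vector `e₀ = (1/w_c)_c`).

[Martin2018, §3.3]: "`M_k^χ(O) = S_k^χ(O) ⊕ ℂ𝟙` if `k = 0` and `χ = +_𝔑`; else `M_k^χ(O) = S_k^χ(O)`", and (3.9)
`h_{B,𝔐} = |Cl_𝔐(O)| = 1 + dim S_2^{new,−_𝔐}(𝔑)`. In the tree's coordinates on the Brandt module `ℚ^{Cls O}` (the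
divisor basis `e_c` of `ℤ[Cls O]`; Gross's pairing `⟨e_c, e_{c'}⟩ = w_c δ_{c c'}`, degree `deg e_c = 1`, Eisenstein vector
`e₀ = ∑ e_c / w_c`, [Gross1987, §1]) this reads, for every Brandt setup `S`, every finite `T` and every sign pattern `χ`:

* §1 DEFINITION `XiSetup.degree` (`deg v = ∑_c v_c`, a linear form), `degree_comp_atkinLehner` (`deg (v ∘ W_r) = deg v`),
  `inv_weight_mem_signSpace_one` (`e₀ ∈ M^{+_T}(O)`: the weights are `W_r`-invariant), `degree_inv_weight_pos`;
* §2 ★ **`degree_eq_zero_of_mem_signSpace`** (`χ ≠ +_T ⇒ deg v = 0` for `v ∈ M^χ(O)`), ★ **`sum_div_weight_eq_zero_of_mem_signSpace`**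
  (`χ ≠ +_T ⇒ ∑_c v_c / w_c = 0`), **`sum_weight_mul_mul_eq_zero_of_mem_signSpace`** (`χ ≠ χ' ⇒ ⟨v, v'⟩ = ∑_c w_c v_c v'_c = 0`:
  distinct sign spaces are orthogonal for Gross's pairing), `sum_mul_eq_zero_of_mem_signSpace`;
* §3 ★ **`finrank_signSpace_one_inf_ker_degree`** (`dim (M^{+_T}(O) ∩ ker deg) = h_T − 1`, Martin's `h_𝔐 = 1 + dim S^{+_𝔐}`),
  `signSpace_le_ker_degree` (`χ ≠ +_T ⇒ M^χ(O) ≤ ker deg`), `finrank_ker_degree` (`= h − 1`),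
  `finrank_signSpace_one_inf_ker_degree_add_sum` (`(h_T − 1) + ∑_{χ ≠ +} dim M^χ(O) = h − 1`).

## References

* [Martin2018] K. Martin, *Congruences for modular forms mod 2 and quaternionic `S`-ideal classes*, Canad. J. Math. 70
  (2018) (held: arXiv 1701.07864): §3.1 (the inner product (3.1)), §3.3, (3.9).
* [Gross1987] B. H. Gross, *Heights and the special values of L-series*, CMS Conf. Proc. 7 (1987), §1 (`deg`, `e₀`,
  `⟨e_i, e_j⟩ = w_i δ_ij`).
* [Voight2021] J. Voight, *Quaternion Algebras*, GTM 288 (2021): 41.1.3, (41.2.4) (the Eisenstein vector).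

## Scope (honest)

Weight `0`, `F = ℚ`; "cuspidal" is the degree-zero hyperplane `ker deg` of the divisor coordinates (equivalently the
orthogonal complement of `e₀` for Gross's pairing), which corresponds to Martin's `S_0(O)` under `φ ↦ (φ(x_c)/w_c)_c`; no
statement about classical cusp forms is made. One definition (`degree`), theorems otherwise; no named fact, no instance.
-/

noncomputable section

open scoped Pointwise

namespace Literature.NumberTheory.Automorphic

namespace Brandt

variable {Nplus Nminus : ℕ} (S : XiSetup Nplus Nminus) [Fintype (ClassSet S.O)]

/-! ## §1 The degree form and the Eisenstein vector -/

/-- **The degree `deg v = ∑_c v_c`** of a vector of the Brandt module (Gross's `deg : ℤ[Cls O] → ℤ`, `deg e_c = 1`,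
extended to `ℚ`). [cite: Gross1987, §1] -/
def XiSetup.degree : (ClassSet S.O → ℚ) →ₗ[ℚ] ℚ := ∑ c : ClassSet S.O, LinearMap.proj c

/-- `deg v = ∑_c v_c`. [cite: Gross1987, §1] -/
theorem XiSetup.degree_apply (v : ClassSet S.O → ℚ) : S.degree v = ∑ c, v c := by
  rw [XiSetup.degree, LinearMap.sum_apply]
  rfl

/-- `deg (v ∘ W_r) = deg v` (reindex along the involution). [cite: Gross1987, §1] [cite: Martin2018, §4.1] -/
theorem XiSetup.degree_comp_atkinLehner (r : ℕ) (v : ClassSet S.O → ℚ) : S.degree (v ∘ S.atkinLehner r) = S.degree v := by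
  rw [S.degree_apply, S.degree_apply]
  exact Fintype.sum_bijective (S.atkinLehner r) (S.involutive_atkinLehner r).bijective _ _ fun _ => rfl

/-- `∑_c f(W_r c) = ∑_c f(c)`. [cite: Martin2018, §4.1] -/
theorem XiSetup.sum_comp_atkinLehner (r : ℕ) (f : ClassSet S.O → ℚ) : ∑ c, f (S.atkinLehner r c) = ∑ c, f c :=
  Fintype.sum_bijective (S.atkinLehner r) (S.involutive_atkinLehner r).bijective _ _ fun _ => rfl

omit [Fintype (ClassSet S.O)] in
/-- **Gross's Eisenstein vector `e₀ = (1/w_c)_c` lies in `M^{+_T}(O)` for every `T`** (the weights are `W_r`-invariant).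
[cite: Gross1987, §1 (`e₀ = Σ e_i/w_i`)] [cite: Martin2018, §3.3 (`𝟙 ∈ M^{+_𝔑}`)] -/
theorem XiSetup.inv_weight_mem_signSpace_one (T : Finset ℕ) :
    (fun c : ClassSet S.O => ((weight S.O c : ℚ))⁻¹) ∈ S.signSpace T 1 := by
  rw [S.mem_signSpace_iff]
  intro r c
  rw [S.weight_atkinLehner, Pi.one_apply, Units.val_one, Int.cast_one, one_mul]

/-- `deg e₀ = ∑_c 1/w_c > 0` (Eichler's mass). [cite: Gross1987, §1 (1.2)] [cite: Voight2021, 25.3.18] -/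
theorem XiSetup.degree_inv_weight_pos : 0 < S.degree fun c : ClassSet S.O => ((weight S.O c : ℚ))⁻¹ := by
  rw [S.degree_apply]
  haveI : Nonempty (ClassSet S.O) := S.nonempty_classSet
  exact Finset.sum_pos (fun c _ => inv_pos.mpr (Nat.cast_pos.mpr (S.one_le_weight c))) Finset.univ_nonempty

/-! ## §2 Nontrivial sign patterns have degree zero and are orthogonal to `e₀` -/

section SignSpace

variable {T : Finset ℕ}

/-- A sign pattern `χ ≠ +` takes the value `−1` somewhere. [folklore] -/
private theorem exists_eq_neg_one_of_ne_one {χ : T → ℤˣ} (hχ : χ ≠ 1) : ∃ r : T, χ r = -1 := by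
  by_contra h
  push Not at h
  exact hχ (funext fun r => (Int.units_eq_one_or (χ r)).resolve_right (h r))

/-- The mechanism: a `W_r`-invariant weight `f` and `v(W_r c) v'(W_r c) = −v(c) v'(c)` force `∑ f v v' = 0`. [folklore] -/
private theorem sum_eq_zero_of_anti {r : ℕ} {f g : ClassSet S.O → ℚ} (hf : ∀ c, f (S.atkinLehner r c) = f c)
    (hg : ∀ c, g (S.atkinLehner r c) = -g c) : ∑ c, f c * g c = 0 := by
  have h := S.sum_comp_atkinLehner r fun c => f c * g c
  have h' : ∑ c, f (S.atkinLehner r c) * g (S.atkinLehner r c) = ∑ c, -(f c * g c) :=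
    Finset.sum_congr rfl fun c _ => by rw [hf c, hg c, mul_neg]
  rw [h', Finset.sum_neg_distrib] at h
  linarith

/-- **`deg v = 0` for `v ∈ M^χ(O)`, `χ ≠ +_T`**: the nontrivial sign patterns live in the degree-zero part
(`M^χ = S^χ` unless `χ = +`). [cite: Martin2018, §3.3] [cite: Gross1987, §1] -/
theorem XiSetup.degree_eq_zero_of_mem_signSpace {χ : T → ℤˣ} (hχ : χ ≠ 1) {v : ClassSet S.O → ℚ}
    (hv : v ∈ S.signSpace T χ) : S.degree v = 0 := by
  obtain ⟨r, hr⟩ := exists_eq_neg_one_of_ne_one hχ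
  rw [S.mem_signSpace_iff] at hv
  rw [S.degree_apply]
  have h := sum_eq_zero_of_anti S (r := r) (f := fun _ => (1 : ℚ)) (g := v) (fun _ => rfl) fun c => by
    rw [hv r c, hr, Units.val_neg, Units.val_one, Int.cast_neg, Int.cast_one, neg_one_mul]
  simpa only [one_mul] using h

/-- The same as a plain sum: `∑_c v_c = 0`. [cite: Martin2018, §3.3] -/
theorem XiSetup.sum_eq_zero_of_mem_signSpace {χ : T → ℤˣ} (hχ : χ ≠ 1) {v : ClassSet S.O → ℚ}
    (hv : v ∈ S.signSpace T χ) : ∑ c, v c = 0 := by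
  rw [← S.degree_apply]; exact S.degree_eq_zero_of_mem_signSpace hχ hv

/-- **`∑_c v_c / w_c = 0` for `v ∈ M^χ(O)`, `χ ≠ +_T`**: the nontrivial sign patterns are orthogonal to the Eisenstein
vector (Martin's `(φ, 𝟙) = 0`, the inner product (3.1) weighted by `|Γ_i|⁻¹`). [cite: Martin2018, §3.1 (3.1) and §3.3] [cite: Gross1987, §1] -/
theorem XiSetup.sum_div_weight_eq_zero_of_mem_signSpace {χ : T → ℤˣ} (hχ : χ ≠ 1) {v : ClassSet S.O → ℚ}
    (hv : v ∈ S.signSpace T χ) : ∑ c, v c / (weight S.O c : ℚ) = 0 := by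
  obtain ⟨r, hr⟩ := exists_eq_neg_one_of_ne_one hχ
  rw [S.mem_signSpace_iff] at hv
  have h := sum_eq_zero_of_anti S (r := r) (f := fun c => ((weight S.O c : ℚ))⁻¹) (g := v)
    (fun c => by rw [S.weight_atkinLehner]) fun c => by
    rw [hv r c, hr, Units.val_neg, Units.val_one, Int.cast_neg, Int.cast_one, neg_one_mul]
  simpa only [inv_mul_eq_div] using h

/-- **Distinct sign spaces are orthogonal for Gross's pairing: `∑_c w_c v_c v'_c = 0`** for `v ∈ M^χ(O)`, `v' ∈ M^{χ'}(O)`,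
`χ ≠ χ'` (each `W_r` is a self-adjoint involution). [cite: Gross1987, §1 (`⟨e_i, e_j⟩ = w_i δ_ij`)] [cite: Martin2018, §3.1 ("a commuting family of diagonalizable operators")] -/
theorem XiSetup.sum_weight_mul_mul_eq_zero_of_mem_signSpace {χ χ' : T → ℤˣ} (hχ : χ ≠ χ') {v v' : ClassSet S.O → ℚ}
    (hv : v ∈ S.signSpace T χ) (hv' : v' ∈ S.signSpace T χ') : ∑ c, (weight S.O c : ℚ) * (v c * v' c) = 0 := by
  obtain ⟨r, hr⟩ : ∃ r : T, χ r ≠ χ' r := by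
    by_contra h
    push Not at h
    exact hχ (funext h)
  have hprod : ((χ r : ℤ) : ℚ) * ((χ' r : ℤ) : ℚ) = -1 := by
    rcases Int.units_eq_one_or (χ r) with h1 | h1 <;> rcases Int.units_eq_one_or (χ' r) with h2 | h2
    · exact absurd (h1.trans h2.symm) hr
    · rw [h1, h2]; norm_num
    · rw [h1, h2]; norm_num
    · exact absurd (h1.trans h2.symm) hr
  rw [S.mem_signSpace_iff] at hv hv'
  exact sum_eq_zero_of_anti S (r := r) (f := fun c => (weight S.O c : ℚ)) (g := fun c => v c * v' c)
    (fun c => by rw [S.weight_atkinLehner]) fun c => by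
      rw [hv r c, hv' r c]
      linear_combination (v c * v' c) * hprod

/-- The unweighted form: `∑_c v_c v'_c = 0` for `v ∈ M^χ(O)`, `v' ∈ M^{χ'}(O)`, `χ ≠ χ'`. [cite: Martin2018, §3.1] -/
theorem XiSetup.sum_mul_eq_zero_of_mem_signSpace {χ χ' : T → ℤˣ} (hχ : χ ≠ χ') {v v' : ClassSet S.O → ℚ}
    (hv : v ∈ S.signSpace T χ) (hv' : v' ∈ S.signSpace T χ') : ∑ c, v c * v' c = 0 := by
  obtain ⟨r, hr⟩ : ∃ r : T, χ r ≠ χ' r := by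
    by_contra h
    push Not at h
    exact hχ (funext h)
  have hprod : ((χ r : ℤ) : ℚ) * ((χ' r : ℤ) : ℚ) = -1 := by
    rcases Int.units_eq_one_or (χ r) with h1 | h1 <;> rcases Int.units_eq_one_or (χ' r) with h2 | h2
    · exact absurd (h1.trans h2.symm) hr
    · rw [h1, h2]; norm_num
    · rw [h1, h2]; norm_num
    · exact absurd (h1.trans h2.symm) hr
  rw [S.mem_signSpace_iff] at hv hv'
  have h := sum_eq_zero_of_anti S (r := r) (f := fun _ => (1 : ℚ)) (g := fun c => v c * v' c) (fun _ => rfl) fun c => by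
    rw [hv r c, hv' r c]
    linear_combination (v c * v' c) * hprod
  simpa only [one_mul] using h

end SignSpace

/-! ## §3 `dim (M^{+_T}(O) ∩ ker deg) = h_T − 1` -/

/-- A line functional nonzero on a subspace cuts a hyperplane out of it. [folklore] -/
private theorem finrank_inf_ker_add_one {V : Type*} [AddCommGroup V] [Module ℚ V] [FiniteDimensional ℚ V]
    (P : Submodule ℚ V) (f : V →ₗ[ℚ] ℚ) {x : V} (hx : x ∈ P) (hfx : f x ≠ 0) :
    Module.finrank ℚ ↥(P ⊓ LinearMap.ker f) + 1 = Module.finrank ℚ P := by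
  set g : P →ₗ[ℚ] ℚ := f.domRestrict P with hg
  have hrange : LinearMap.range g = ⊤ := by
    rw [eq_top_iff]
    rintro a -
    refine ⟨(a / f x) • ⟨x, hx⟩, ?_⟩
    rw [map_smul, hg, LinearMap.domRestrict_apply, smul_eq_mul, div_mul_cancel₀ a hfx]
  have hker' : LinearMap.ker g = Submodule.comap P.subtype (LinearMap.ker f) := by rw [hg]; rfl
  have hker : Module.finrank ℚ (LinearMap.ker g) = Module.finrank ℚ ↥(P ⊓ LinearMap.ker f) := by
    rw [← Submodule.finrank_map_subtype_eq P (LinearMap.ker g), hker', Submodule.map_comap_subtype]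
  have h := LinearMap.finrank_range_add_finrank_ker g
  rw [hrange, finrank_top, Module.finrank_self, hker] at h
  omega

/-- `χ ≠ +_T ⇒ M^χ(O) ≤ ker deg`. [cite: Martin2018, §3.3] -/
theorem XiSetup.signSpace_le_ker_degree {T : Finset ℕ} {χ : T → ℤˣ} (hχ : χ ≠ 1) :
    S.signSpace T χ ≤ LinearMap.ker S.degree := fun _ hv =>
  LinearMap.mem_ker.mpr (S.degree_eq_zero_of_mem_signSpace hχ hv)

/-- `dim ker deg = h − 1`. [cite: Gross1987, §1 (`ℤ[Cls O]⁰`)] -/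
theorem XiSetup.finrank_ker_degree : Module.finrank ℚ (LinearMap.ker S.degree) + 1 = Nat.card (ClassSet S.O) := by
  have h := finrank_inf_ker_add_one ⊤ S.degree (x := fun c => ((weight S.O c : ℚ))⁻¹) Submodule.mem_top
    (ne_of_gt S.degree_inv_weight_pos)
  rw [finrank_top, Module.finrank_fintype_fun_eq_card, ← Nat.card_eq_fintype_card] at h
  rw [← h, top_inf_eq]

/-- **`dim (M^{+_T}(O) ∩ ker deg) = h_T − 1`**: the `+_T`-part of the degree-zero (cuspidal) submodule has dimension one
less than Martin's `T`-ideal class number (`e₀ ∈ M^{+_T}` has positive degree) — the quaternionic side of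
`h_{B,𝔐} = 1 + dim S^{new,−_𝔐}`. [cite: Martin2018, (3.9) and §3.3] [cite: Gross1987, §1] -/
theorem XiSetup.finrank_signSpace_one_inf_ker_degree (T : Finset ℕ) :
    Module.finrank ℚ ↥(S.signSpace T 1 ⊓ LinearMap.ker S.degree) + 1 = Nat.card (S.SClassSet T) := by
  rw [← S.finrank_signSpace_one_eq_natCard_sClassSet T]
  exact finrank_inf_ker_add_one _ S.degree (S.inv_weight_mem_signSpace_one T) (ne_of_gt S.degree_inv_weight_pos)

open Classical in
/-- **`(h_T − 1) + ∑_{χ ≠ +_T} dim M^χ(O) = h − 1`**: the degree-zero part is accounted for by the cuspidal `+_T`-part and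
the nontrivial sign patterns. [cite: Martin2018, §3.3 and (3.9)] -/
theorem XiSetup.finrank_signSpace_one_inf_ker_degree_add_sum (T : Finset ℕ) :
    Module.finrank ℚ ↥(S.signSpace T 1 ⊓ LinearMap.ker S.degree) +
        ∑ χ ∈ (Finset.univ : Finset (T → ℤˣ)).erase 1, Module.finrank ℚ (S.signSpace T χ) =
      Module.finrank ℚ (LinearMap.ker S.degree) := by
  have h1 := S.finrank_signSpace_one_inf_ker_degree T
  have h2 := S.finrank_ker_degree
  have h3 := S.sum_finrank_signSpace_ne_one_eq T
  have h4 := S.natCard_sClassSet_le_natCard_classSet T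
  omega

end Brandt

end Literature.NumberTheory.Automorphic
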